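import Summits.ResolutionOfSingularities.ResolutionOfSingularities.Theorems.WeightedInvariantWeightedConstructionExtReesBridge
import Summits.ResolutionOfSingularities.ResolutionOfSingularities.Theorems.WeightedInvariantWeightedConstructionCobordantBlowupRegular
import Summits.ResolutionOfSingularities.ResolutionOfSingularities.Theorems.WeightedInvariantWeightedConstructionCobordantPlusSmooth

/-!
# `B₊(U) → Spec k` is smooth, separated and quasi-compact (Włodarczyk 2.3.9 for the datum's charts)

Route `ResolutionOfSingularities/WeightedInvariant`, crux `WeightedConstruction` (stmt-0571), line
`support-first-weights-second`. The planner's registered infrastructure stub `stub_cobordantPlus_smooth`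
VERBATIM (no extra hypotheses): for a regular weighted centre `R` (`ReesAlgebraData.IsRegularWeightedCentre`)
on a smooth separated quasi-compact scheme `Y` over a perfect field and EVERY affine open `U ⊆ Y`, the
cobordant chart `R.cobordantPlusι U ≫ f : B₊(U) → U ⊆ Y → Spec k` is smooth, separated and quasi-compact —
so the axioms of `WeightedResolutionDatum` apply to `(B₊(U), strict transform)` again (also needed by the
sibling items `DatumToEmbedded` / `DatumToResolution`, stmt-0572/8974). It is the composition of three landed
lemmas of this line: the bridge `extReesAlgebra F.ideal = F.extendedRees` (`Theorems.stub_extRees_bridge`),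
regularity and finite type of the full cobordant blow-up `Spec Γ(U)[t⁻¹, Rₙ(U) tⁿ]` over an ARBITRARY affine
chart (`Theorems.stub_cobordantBlowup_regular`), and the passage to the open subscheme `B₊(U)`
(`Theorems.stub_cobordantPlus_smooth`, hypothesis form). Declared in the sub-namespace `Theorems.SupportFirst`
because the hypothesis form already owns the name `Theorems.stub_cobordantPlus_smooth`.
-/

set_option linter.dupNamespace false -- mandated namespace of this single-conjunct summit

noncomputable section

open CategoryTheory AlgebraicGeometry Literature.AlgebraicGeometry.Resolution

namespace Summit.ResolutionOfSingularities.ResolutionOfSingularities.Theorems.SupportFirst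

/-- **Włodarczyk 2.3.9 for the datum's cobordant charts, unconditional form** (registered stub
`stub_cobordantPlus_smooth`, verbatim): for a regular weighted centre `R` on a smooth separated
quasi-compact `Y` over a perfect field `k` and every affine open `U`, `B₊(U) → Spec k` is smooth, separated
and quasi-compact. -/
theorem stub_cobordantPlus_smooth :
    ∀ ⦃k : Type⦄ [Field k] [PerfectField k] ⦃Y : Scheme.{0}⦄ (f : Y ⟶ Spec (.of k)) [Smooth f]
      [IsSeparated f] [QuasiCompact f] (R : ReesAlgebraData Y), R.IsRegularWeightedCentre →
      ∀ U : Y.affineOpens, Smooth (R.cobordantPlusι U ≫ f) ∧ IsSeparated (R.cobordantPlusι U ≫ f) ∧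
        QuasiCompact (R.cobordantPlusι U ≫ f) :=
  Theorems.stub_cobordantPlus_smooth (Theorems.stub_cobordantBlowup_regular Theorems.stub_extRees_bridge)

end Summit.ResolutionOfSingularities.ResolutionOfSingularities.Theorems.SupportFirst

end
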